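import Mathlib
import HarnessLib
import Summits.QuantumFields.YangMills.Theorems.ComplexCouplingChannelContinuumLegGivenGapPtuDerivativesBlocks
import Summits.QuantumFields.YangMills.Theorems.ComplexCouplingChannelContinuumLegGivenGapPtuDerivativesSupports

/-!
# `ContinuumLegGivenGap` (stmt-QuantumFields-15828), line `alternating-curvature-arrays`: `stub_ptuDerivatives`, helper 4 — derivatives of the normaliser on the support of a piece, and of the piece weights

Support file for the registered stub `stub_ptuDerivatives` (derivative bounds of the Whitney system of
`stub_productToUniform`).  At a point `y` of `tsupport φ̃_{m,v,z}` (level `m`, physical cell side `ℓ = a · 3^m/2`),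
with `B = 2²⁵ (N+1)²/ℓ`:

* §1 the terms of `W = near + out + ∑_{m'} ∑_{(v',z')} φ*_{m',v',z'}` have geometric bounds of comparable scale:
  `near` (`(p² B)ⁱ`: either its ramp `R a/4` is `≥ 15ℓ/4`, or `near` vanishes identically near `y`), `out`
  (`(2p B)ⁱ`, ramp `aL/8 ≥ ℓ/12`), each `φ*_{m'}` meeting `y` (`(6p(2p+1) B)ⁱ`, levels `|m' - m| ≤ 1`); for each
  level and offset at most ONE cell assignment meets `y`, so the double sum is locally a sum of `≤ 3 (2p+1)^4` terms;
  hence `‖Dⁱ W (y)‖ ≤ (C_p B)ⁱ` for `1 ≤ i ≤ N`, `C_p = (2 + 3(2p+1)^4) · 6p(2p+1)`;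
* §2 `W` is smooth; `1/W` at `y` by the Faà di Bruno bound of helper 1 (`W ≥ 1`); the piece weight `φ̃/W` by the
  two-factor Leibniz bound: `‖Dⁿ(φ̃/W)(y)‖ ≤ ((n+1)² (2p(2p+1) + C_p) 2²⁵ (n+1)²/ℓ)ⁿ` for ALL `n` and `y` (registered
  anchor `ptuDeriv_weight_bound`).

Mathlib + helpers 1–3 only; no definitions. [folklore]
-/

set_option autoImplicit false

noncomputable section

open scoped Classical

namespace Summit.QuantumFields.YangMills.Theorems.ContinuumLegGivenGap

open scoped BigOperators ContDiff
open Filter Topology Set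
open Summit.QuantumFields.YangMills.Theorems.ContinuumLegGivenGap.AlternatingArrays
open Literature.Analysis.FunctionSpaces (norm_iteratedFDeriv_mul_le_add_pow)

/-! ## §1 The terms of the normaliser at a support point -/

section Terms

variable {E F : Type*} [NormedAddCommGroup E] [NormedSpace ℝ E] [NormedAddCommGroup F] [NormedSpace ℝ F]

/-- Off the topological support all iterated derivatives vanish. [folklore] -/
theorem ptuDeriv_iteratedFDeriv_eq_zero {f : E → F} {x : E} (hx : x ∉ tsupport f) (i : ℕ) :
    iteratedFDeriv ℝ i f x = 0 :=
  Function.notMem_support.1 fun h => hx (support_iteratedFDeriv_subset i h)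

end Terms

/-- Monotonicity of the geometric constant in the ramp. [folklore] -/
theorem ptuDeriv_div_le_div {X r s : ℝ} (hX : 0 ≤ X) (hs : 0 < s) (h : s ≤ r) : X / r ≤ X / s :=
  div_le_div_of_nonneg_left hX hs h

/-- On `tsupport φ̃_{m,v,z}` all pairs of points are `≥ 15 ℓ` apart in some coordinate. [folklore] -/
theorem ptuDeriv_pairs_far {a : ℝ} (ha : 0 < a) {L p m : ℕ} (hp : 2 ≤ p) (hm : m ∈ ptuLevels L p)
    {vz : (Fin 4 → ℤ) × (Fin p → Fin 4 → ℤ)} (hvz : vz ∈ ptuIdx L m p) {y : (Fin p → EuclideanSpace ℝ (Fin 4))}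
    (hy : y ∈ tsupport (ptuPhiTilde a m p vz.1 vz.2)) :
    ∀ i j : Fin p, i ≠ j → ∃ μ, 15 * (a * cellSide m) ≤ |y i μ - y j μ| := by
  intro i j hij
  have hc := ptuDeriv_tsupport_phiTilde ha hm hp vz.1 vz.2 hy
  obtain ⟨-, hfar, -⟩ := (Finset.mem_filter.1 hvz).2
  exact ptuDeriv_physCore_far ha m vz.1 (vz.2 i) (vz.2 j) (hfar i j hij) (hc i) (hc j)

/-- **The near term**: `‖Dⁱ near (y)‖ ≤ (p² · 2²⁵ (N+1)²/ℓ)ⁱ` for `i ≤ N` at every `y ∈ tsupport φ̃_{m,v,z}`.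
[folklore] -/
theorem ptuDeriv_near_term {a : ℝ} (ha : 0 < a) {L p m : ℕ} (hp : 2 ≤ p) (hm : m ∈ ptuLevels L p)
    {vz : (Fin 4 → ℤ) × (Fin p → Fin 4 → ℤ)} (hvz : vz ∈ ptuIdx L m p) (N : ℕ) {y : (Fin p → EuclideanSpace ℝ (Fin 4))}
    (hy : y ∈ tsupport (ptuPhiTilde a m p vz.1 vz.2)) :
    ∀ i ≤ N, ‖iteratedFDeriv ℝ i (ptuNear a p) y‖ ≤ ((p : ℝ) ^ 2 * (2 ^ 25 * ((N : ℝ) + 1) ^ 2 / (a * cellSide m))) ^ i := by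
  intro i hi
  have hℓ : 0 < a * cellSide m := by unfold cellSide; positivity
  by_cases hcase : 15 * (a * cellSide m) ≤ (ptuR p : ℝ) * a
  · refine ((ptuDeriv_near_bound a p N ha).2.2 i hi y).trans (pow_le_pow_left₀ (by positivity) ?_ i)
    exact mul_le_mul_of_nonneg_left (ptuDeriv_div_le_div (by positivity) hℓ (by linarith)) (by positivity)
  · have hnot : y ∉ tsupport (ptuNear a p) := by
      refine ptuDeriv_not_mem_tsupport_near ha fun i' j' hij => ?_
      obtain ⟨μ, hμ⟩ := ptuDeriv_pairs_far ha hp hm hvz hy i' j' hij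
      exact ⟨μ, by linarith⟩
    rw [ptuDeriv_iteratedFDeriv_eq_zero hnot i, norm_zero]
    positivity

/-- **The outer term**: `‖Dⁱ out (y)‖ ≤ (2p · 2²⁵ (N+1)²/ℓ)ⁱ` for `i ≤ N` (everywhere; `aL ≥ ℓ/2`). [folklore] -/
theorem ptuDeriv_out_term {a : ℝ} (ha : 0 < a) {L p m : ℕ} (hL : 1 ≤ L) (hm : m ∈ ptuLevels L p) (N : ℕ)
    (y : (Fin p → EuclideanSpace ℝ (Fin 4))) :
    ∀ i ≤ N, ‖iteratedFDeriv ℝ i (ptuOut a L p) y‖ ≤ (2 * (p : ℝ) * (2 ^ 25 * ((N : ℝ) + 1) ^ 2 / (a * cellSide m))) ^ i := by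
  intro i hi
  have hℓ : 0 < a * cellSide m := by unfold cellSide; positivity
  have h3 := ptuDeriv_level_pow_le_L hm hL
  have hle : a * cellSide m / 2 ≤ a * (L : ℝ) := by
    have h' : a * (3 : ℝ) ^ m ≤ 3 * (a * L) := by
      have h'' := mul_le_mul_of_nonneg_left h3 ha.le
      rwa [show a * (3 * (L : ℝ)) = 3 * (a * L) by ring] at h''
    have haL : 0 ≤ a * (L : ℝ) := by positivity
    unfold cellSide
    rw [show a * ((3 : ℝ) ^ m / 2) / 2 = (a * 3 ^ m) / 4 by ring]
    linarith
  refine ((ptuDeriv_out_bound ha hL p N).2.2 i hi y).trans (pow_le_pow_left₀ (by positivity) ?_ i)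
  have h := ptuDeriv_div_le_div (X := 2 ^ 25 * ((N : ℝ) + 1) ^ 2) (by positivity) (by positivity) hle
  calc (p : ℝ) * (2 ^ 25 * ((N : ℝ) + 1) ^ 2 / (a * L)) ≤ (p : ℝ) * (2 ^ 25 * ((N : ℝ) + 1) ^ 2 / (a * cellSide m / 2)) :=
        mul_le_mul_of_nonneg_left h (Nat.cast_nonneg _)
    _ = 2 * (p : ℝ) * (2 ^ 25 * ((N : ℝ) + 1) ^ 2 / (a * cellSide m)) := by
        rw [div_div_eq_mul_div]; ring

/-- **One `φ*` term meeting the point**: levels are adjacent and `‖Dⁱ φ*_{m',v',z'}(y)‖ ≤ (6p(2p+1) · 2²⁵ (N+1)²/ℓ)ⁱ`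
for `i ≤ N`. [folklore] -/
theorem ptuDeriv_phiStar_term {a : ℝ} (ha : 0 < a) {L p m m' : ℕ} (hp : 2 ≤ p) (hm : m ∈ ptuLevels L p)
    (hm' : m' ∈ ptuLevels L p) {vz : (Fin 4 → ℤ) × (Fin p → Fin 4 → ℤ)} (hvz : vz ∈ ptuIdx L m p)
    {vz' : (Fin 4 → ℤ) × (Fin p → Fin 4 → ℤ)} (hvz' : vz' ∈ ptuIdx L m' p) (N : ℕ)
    {y : (Fin p → EuclideanSpace ℝ (Fin 4))} (hy : y ∈ tsupport (ptuPhiTilde a m p vz.1 vz.2))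
    (hy' : y ∈ tsupport (ptuPhiStar a m' p vz'.1 vz'.2)) :
    ∀ i ≤ N, ‖iteratedFDeriv ℝ i (ptuPhiStar a m' p vz'.1 vz'.2) y‖ ≤
      (6 * (p : ℝ) * (2 * p + 1) * (2 ^ 25 * ((N : ℝ) + 1) ^ 2 / (a * cellSide m))) ^ i := by
  intro i hi
  have hℓ : 0 < a * cellSide m := by unfold cellSide; positivity
  obtain ⟨-, h2⟩ := ptuDeriv_levels_close a L p m m' ha hp hm hm' vz hvz vz' hvz' y hy hy'
  have hd := ptuDeriv_level_D_ge hm'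
  have hdpos : 0 < ptuD m' p := by omega
  have hdS := ptuDeriv_cellSide_le_D hm'
  -- `ℓ_m ≤ 3 ℓ_{m'} ≤ 6 (2p+1) a d'`
  have hS : cellSide m ≤ 3 * cellSide m' := by
    unfold cellSide
    have h : (3 : ℝ) ^ m ≤ 3 ^ (m' + 1) := pow_le_pow_right₀ (by norm_num) h2
    rw [pow_succ] at h
    linarith
  have hle : a * cellSide m ≤ 6 * (2 * (p : ℝ) + 1) * (a * ptuD m' p) := by
    have h := mul_le_mul_of_nonneg_left (hS.trans (mul_le_mul_of_nonneg_left hdS (by norm_num))) ha.le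
    linarith
  refine ((ptuDeriv_phiStar_bound ha m' p hdpos vz'.1 vz'.2 N).2.2 i hi y).trans (pow_le_pow_left₀ (by positivity) ?_ i)
  set X : ℝ := 2 ^ 25 * ((N : ℝ) + 1) ^ 2 with hX
  have hX0 : 0 ≤ X := by positivity
  have had : 0 < a * (ptuD m' p : ℝ) := by
    have : (0 : ℝ) < ptuD m' p := by exact_mod_cast hdpos
    positivity
  have key : X / (a * ptuD m' p) ≤ 6 * (2 * (p : ℝ) + 1) * X / (a * cellSide m) := by
    rw [div_le_div_iff₀ had hℓ]
    calc X * (a * cellSide m) ≤ X * (6 * (2 * (p : ℝ) + 1) * (a * ptuD m' p)) := mul_le_mul_of_nonneg_left hle hX0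
      _ = 6 * (2 * (p : ℝ) + 1) * X * (a * ptuD m' p) := by ring
  calc (p : ℝ) * (X / (a * ptuD m' p)) ≤ (p : ℝ) * (6 * (2 * (p : ℝ) + 1) * X / (a * cellSide m)) :=
        mul_le_mul_of_nonneg_left key (Nat.cast_nonneg _)
    _ = 6 * (p : ℝ) * (2 * p + 1) * (X / (a * cellSide m)) := by ring

/-- There are at most `(2p+1)^4` offsets. [folklore] -/
theorem ptuDeriv_card_offsets_le (m p : ℕ) : (ptuOffsets m p).card ≤ (2 * p + 1) ^ 4 := by
  unfold ptuOffsets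
  refine Finset.card_image_le.trans ?_
  rw [Finset.card_univ, Fintype.card_fun, Fintype.card_fin, Fintype.card_fin]

/-- **Multiplicity**: for a fixed level and at a fixed point, the pieces whose bump `φ*` meets the point number at most
`(2p+1)^4` (one cell assignment per offset). [folklore] -/
theorem ptuDeriv_card_meeting_le {a : ℝ} (ha : 0 < a) {L p m' : ℕ} (hp : 2 ≤ p) (hm' : m' ∈ ptuLevels L p)
    (y : (Fin p → EuclideanSpace ℝ (Fin 4))) :
    ((ptuIdx L m' p).filter fun vz' => y ∈ tsupport (ptuPhiStar a m' p vz'.1 vz'.2)).card ≤ (2 * p + 1) ^ 4 := by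
  refine le_trans ?_ (ptuDeriv_card_offsets_le m' p)
  refine Finset.card_le_card_of_injOn Prod.fst (fun vz' hvz' => ?_) ?_
  · have h := (Finset.mem_filter.1 (Finset.mem_filter.1 (Finset.mem_coe.1 hvz')).1).1
    exact Finset.mem_coe.2 (Finset.mem_product.1 h).1
  · intro vz' hvz' vz'' hvz'' heq
    have h1 := (Finset.mem_filter.1 (Finset.mem_coe.1 hvz')).2
    have h2 := (Finset.mem_filter.1 (Finset.mem_coe.1 hvz'')).2
    have hc1 := ptuDeriv_tsupport_phiStar ha hm' hp vz'.1 vz'.2 h1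
    have hc2 := ptuDeriv_tsupport_phiStar ha hm' hp vz''.1 vz''.2 h2
    refine Prod.ext heq (funext fun i => ?_)
    have hc2i := hc2 i
    rw [show vz''.1 = vz'.1 from heq.symm] at hc2i
    exact ptuDeriv_physCore_unique ha m' vz'.1 (vz'.2 i) (vz''.2 i) (hc1 i) hc2i

/-- **The sum over one level**: `∑_{(v',z')} ‖Dⁱ φ*_{m',v',z'}(y)‖ ≤ (2p+1)^4 (6p(2p+1) B)ⁱ` if `|m' - m| ≤ 1`, and
`= 0` otherwise. [folklore] -/
theorem ptuDeriv_level_sum_le {a : ℝ} (ha : 0 < a) {L p m m' : ℕ} (hp : 2 ≤ p) (hm : m ∈ ptuLevels L p)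
    (hm' : m' ∈ ptuLevels L p) {vz : (Fin 4 → ℤ) × (Fin p → Fin 4 → ℤ)} (hvz : vz ∈ ptuIdx L m p) (N : ℕ)
    {y : (Fin p → EuclideanSpace ℝ (Fin 4))} (hy : y ∈ tsupport (ptuPhiTilde a m p vz.1 vz.2)) :
    ∀ i ≤ N, ∑ vz' ∈ ptuIdx L m' p, ‖iteratedFDeriv ℝ i (ptuPhiStar a m' p vz'.1 vz'.2) y‖ ≤
      if m' ≤ m + 1 ∧ m ≤ m' + 1 then
        (2 * (p : ℝ) + 1) ^ 4 * (6 * (p : ℝ) * (2 * p + 1) * (2 ^ 25 * ((N : ℝ) + 1) ^ 2 / (a * cellSide m))) ^ i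
      else 0 := by
  intro i hi
  set X : ℝ := 6 * (p : ℝ) * (2 * p + 1) * (2 ^ 25 * ((N : ℝ) + 1) ^ 2 / (a * cellSide m)) with hX
  have hX0 : 0 ≤ X := by rw [hX]; unfold cellSide; positivity
  set T := (ptuIdx L m' p).filter fun vz' => y ∈ tsupport (ptuPhiStar a m' p vz'.1 vz'.2) with hT
  have hpt : ∀ vz' ∈ ptuIdx L m' p, ‖iteratedFDeriv ℝ i (ptuPhiStar a m' p vz'.1 vz'.2) y‖ ≤
      if y ∈ tsupport (ptuPhiStar a m' p vz'.1 vz'.2) then X ^ i else 0 := by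
    intro vz' hvz'
    split_ifs with h
    · exact ptuDeriv_phiStar_term ha hp hm hm' hvz hvz' N hy h i hi
    · rw [ptuDeriv_iteratedFDeriv_eq_zero h i, norm_zero]
  have hsum : ∑ vz' ∈ ptuIdx L m' p, ‖iteratedFDeriv ℝ i (ptuPhiStar a m' p vz'.1 vz'.2) y‖ ≤ T.card * X ^ i := by
    refine (Finset.sum_le_sum hpt).trans (le_of_eq ?_)
    rw [← Finset.sum_filter, Finset.sum_const, nsmul_eq_mul]
  refine hsum.trans ?_
  split_ifs with hclose
  · have hc : (T.card : ℝ) ≤ (2 * (p : ℝ) + 1) ^ 4 := by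
      have h := ptuDeriv_card_meeting_le ha hp hm' y (a := a)
      exact_mod_cast h
    exact mul_le_mul_of_nonneg_right hc (pow_nonneg hX0 i)
  · have hT0 : T.card = 0 := by
      rw [Finset.card_eq_zero, Finset.filter_eq_empty_iff]
      intro vz' hvz' hyvz'
      exact hclose (ptuDeriv_levels_close a L p m m' ha hp hm hm' vz hvz vz' hvz' y hy hyvz')
    rw [hT0, Nat.cast_zero, zero_mul]

/-- **The double sum**: `∑_{m'} ∑_{(v',z')} ‖Dⁱ φ*(y)‖ ≤ 3 (2p+1)^4 (6p(2p+1) B)ⁱ`. [folklore] -/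
theorem ptuDeriv_double_sum_le {a : ℝ} (ha : 0 < a) {L p m : ℕ} (hp : 2 ≤ p) (hm : m ∈ ptuLevels L p)
    {vz : (Fin 4 → ℤ) × (Fin p → Fin 4 → ℤ)} (hvz : vz ∈ ptuIdx L m p) (N : ℕ)
    {y : (Fin p → EuclideanSpace ℝ (Fin 4))} (hy : y ∈ tsupport (ptuPhiTilde a m p vz.1 vz.2)) :
    ∀ i ≤ N, ∑ m' ∈ ptuLevels L p, ∑ vz' ∈ ptuIdx L m' p, ‖iteratedFDeriv ℝ i (ptuPhiStar a m' p vz'.1 vz'.2) y‖ ≤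
      3 * (2 * (p : ℝ) + 1) ^ 4 * (6 * (p : ℝ) * (2 * p + 1) * (2 ^ 25 * ((N : ℝ) + 1) ^ 2 / (a * cellSide m))) ^ i := by
  intro i hi
  set Y : ℝ := (2 * (p : ℝ) + 1) ^ 4 * (6 * (p : ℝ) * (2 * p + 1) * (2 ^ 25 * ((N : ℝ) + 1) ^ 2 / (a * cellSide m))) ^ i
    with hY
  have hY0 : 0 ≤ Y := by rw [hY]; unfold cellSide; positivity
  refine (Finset.sum_le_sum fun m' hm' => ptuDeriv_level_sum_le ha hp hm hm' hvz N hy i hi).trans ?_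
  rw [← Finset.sum_filter, Finset.sum_const, nsmul_eq_mul]
  have hcard : ((ptuLevels L p).filter fun m' => m' ≤ m + 1 ∧ m ≤ m' + 1).card ≤ 3 := by
    refine (Finset.card_le_card (t := Finset.Icc (m - 1) (m + 1)) fun m' hm' => ?_).trans ?_
    · have h := (Finset.mem_filter.1 hm').2
      rw [Finset.mem_Icc]; omega
    · rw [Nat.card_Icc]; omega
  have hcard' : (((ptuLevels L p).filter fun m' => m' ≤ m + 1 ∧ m ≤ m' + 1).card : ℝ) ≤ 3 := by exact_mod_cast hcard
  calc _ ≤ 3 * Y := mul_le_mul_of_nonneg_right hcard' hY0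
    _ = _ := by rw [hY]; ring

/-! ## §2 The normaliser, its inverse and the piece weights -/

/-- The far part `∑_{m'} ∑_{(v',z')} φ*` of the normaliser is smooth. [folklore] -/
theorem ptuDeriv_far_contDiff (a : ℝ) (L p : ℕ) :
    ContDiff ℝ ∞ fun y : (Fin p → EuclideanSpace ℝ (Fin 4)) =>
      ∑ m' ∈ ptuLevels L p, ∑ vz' ∈ ptuIdx L m' p, ptuPhiStar a m' p vz'.1 vz'.2 y :=
  ContDiff.sum fun m' _ => ContDiff.sum fun vz' _ => ptuDeriv_phiStar_contDiff a m' p vz'.1 vz'.2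

/-- **The normaliser is smooth.** [folklore] -/
theorem ptuDeriv_W_contDiff {a : ℝ} (ha : 0 < a) {L : ℕ} (hL : 1 ≤ L) (p : ℕ) : ContDiff ℝ ∞ (ptuW a L p) := by
  have hfun : ptuW a L p = fun y => ptuNear a p y + ptuOut a L p y +
      ∑ m' ∈ ptuLevels L p, ∑ vz' ∈ ptuIdx L m' p, ptuPhiStar a m' p vz'.1 vz'.2 y := rfl
  rw [hfun]
  exact ((ptuDeriv_near_bound a p 0 ha).1.add (ptuDeriv_out_bound ha hL p 0).1).add (ptuDeriv_far_contDiff a L p)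

/-- **The normaliser at a support point**: `‖Dⁱ W (y)‖ ≤ (C_p · 2²⁵ (N+1)²/ℓ)ⁱ` for `1 ≤ i ≤ N`,
`C_p = (2 + 3(2p+1)^4) · 6p(2p+1)`. [folklore] -/
theorem ptuDeriv_W_term {a : ℝ} (ha : 0 < a) {L p m : ℕ} (hL : 1 ≤ L) (hp : 2 ≤ p) (hm : m ∈ ptuLevels L p)
    {vz : (Fin 4 → ℤ) × (Fin p → Fin 4 → ℤ)} (hvz : vz ∈ ptuIdx L m p) (N : ℕ)
    {y : (Fin p → EuclideanSpace ℝ (Fin 4))} (hy : y ∈ tsupport (ptuPhiTilde a m p vz.1 vz.2)) :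
    ∀ i, 1 ≤ i → i ≤ N → ‖iteratedFDeriv ℝ i (ptuW a L p) y‖ ≤
      ((2 + 3 * (2 * (p : ℝ) + 1) ^ 4) * (6 * (p : ℝ) * (2 * p + 1)) * (2 ^ 25 * ((N : ℝ) + 1) ^ 2 / (a * cellSide m))) ^ i := by
  intro i h1i hiN
  set B : ℝ := 2 ^ 25 * ((N : ℝ) + 1) ^ 2 / (a * cellSide m) with hB
  have hB0 : 0 ≤ B := by rw [hB]; unfold cellSide; positivity
  set X : ℝ := 6 * (p : ℝ) * (2 * p + 1) * B with hX
  have hX0 : 0 ≤ X := by positivity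
  have hp0 : (0 : ℝ) ≤ p := Nat.cast_nonneg _
  -- split `W`
  set S : (Fin p → EuclideanSpace ℝ (Fin 4)) → ℝ := fun y =>
    ∑ m' ∈ ptuLevels L p, ∑ vz' ∈ ptuIdx L m' p, ptuPhiStar a m' p vz'.1 vz'.2 y with hS
  have hfun : ptuW a L p = ptuNear a p + ptuOut a L p + S := by
    funext y'; rfl
  have hnc : ContDiff ℝ ∞ (ptuNear a p) := (ptuDeriv_near_bound a p 0 ha).1
  have hoc : ContDiff ℝ ∞ (ptuOut a L p) := (ptuDeriv_out_bound ha hL p 0).1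
  have hSc : ContDiff ℝ ∞ S := ptuDeriv_far_contDiff a L p
  have hi : ∀ {f : (Fin p → EuclideanSpace ℝ (Fin 4)) → ℝ}, ContDiff ℝ ∞ f → ContDiffAt ℝ i f y := fun hf =>
    (hf.of_le (mod_cast le_top)).contDiffAt
  have hno : ContDiffAt ℝ i (ptuNear a p + ptuOut a L p) y := (hi hnc).add (hi hoc)
  rw [hfun, iteratedFDeriv_add_apply hno (hi hSc), iteratedFDeriv_add_apply (hi hnc) (hi hoc)]
  -- the far part
  have hSD : iteratedFDeriv ℝ i S y = ∑ m' ∈ ptuLevels L p, ∑ vz' ∈ ptuIdx L m' p,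
      iteratedFDeriv ℝ i (ptuPhiStar a m' p vz'.1 vz'.2) y := by
    rw [hS, iteratedFDeriv_fun_sum_apply fun m' _ =>
      hi (ContDiff.sum fun vz' _ => ptuDeriv_phiStar_contDiff a m' p vz'.1 vz'.2)]
    exact Finset.sum_congr rfl fun m' _ => iteratedFDeriv_fun_sum_apply fun vz' _ => hi (ptuDeriv_phiStar_contDiff _ _ _ _ _)
  have hSn : ‖iteratedFDeriv ℝ i S y‖ ≤ 3 * (2 * (p : ℝ) + 1) ^ 4 * X ^ i := by
    rw [hSD]
    refine (norm_sum_le _ _).trans ((Finset.sum_le_sum fun m' _ => norm_sum_le _ _).trans ?_)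
    exact ptuDeriv_double_sum_le ha hp hm hvz N hy i hiN
  -- near and out
  have hnear : ‖iteratedFDeriv ℝ i (ptuNear a p) y‖ ≤ X ^ i := by
    refine (ptuDeriv_near_term ha hp hm hvz N hy i hiN).trans (pow_le_pow_left₀ (by positivity) ?_ i)
    have h : (p : ℝ) ^ 2 ≤ 6 * (p : ℝ) * (2 * p + 1) := by nlinarith
    exact mul_le_mul_of_nonneg_right h hB0
  have hout : ‖iteratedFDeriv ℝ i (ptuOut a L p) y‖ ≤ X ^ i := by
    refine (ptuDeriv_out_term ha hL hm N y i hiN).trans (pow_le_pow_left₀ (by positivity) ?_ i)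
    have h : 2 * (p : ℝ) ≤ 6 * (p : ℝ) * (2 * p + 1) := by nlinarith
    exact mul_le_mul_of_nonneg_right h hB0
  -- collect
  have hM : (1 : ℝ) ≤ 2 + 3 * (2 * (p : ℝ) + 1) ^ 4 := by nlinarith [pow_nonneg (by positivity : (0 : ℝ) ≤ 2 * p + 1) 4]
  have hMi : (2 + 3 * (2 * (p : ℝ) + 1) ^ 4) ≤ (2 + 3 * (2 * (p : ℝ) + 1) ^ 4) ^ i := le_self_pow₀ hM (by omega)
  calc ‖iteratedFDeriv ℝ i (ptuNear a p) y + iteratedFDeriv ℝ i (ptuOut a L p) y + iteratedFDeriv ℝ i S y‖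
      ≤ ‖iteratedFDeriv ℝ i (ptuNear a p) y‖ + ‖iteratedFDeriv ℝ i (ptuOut a L p) y‖ + ‖iteratedFDeriv ℝ i S y‖ :=
        norm_add₃_le
    _ ≤ X ^ i + X ^ i + 3 * (2 * (p : ℝ) + 1) ^ 4 * X ^ i := by gcongr
    _ = (2 + 3 * (2 * (p : ℝ) + 1) ^ 4) * X ^ i := by ring
    _ ≤ (2 + 3 * (2 * (p : ℝ) + 1) ^ 4) ^ i * X ^ i := mul_le_mul_of_nonneg_right hMi (pow_nonneg hX0 i)
    _ = ((2 + 3 * (2 * (p : ℝ) + 1) ^ 4) * (6 * (p : ℝ) * (2 * p + 1)) * B) ^ i := by rw [← mul_pow, hX]; ring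

/-- The piece weight is supported in the support of its enlarged bump. [folklore] -/
theorem ptuDeriv_support_weight_subset (a : ℝ) (L p m : ℕ) (v : Fin 4 → ℤ) (z : Fin p → Fin 4 → ℤ) :
    Function.support (ptuWeight a L p m v z) ⊆ Function.support (ptuPhiTilde a m p v z) := by
  intro y hy
  rw [Function.mem_support] at hy ⊢
  intro h0
  exact hy (by unfold ptuWeight; rw [h0, zero_div])

/-- **The piece weights** (registered anchor): given coverage `W ≥ 1`, for every Whitney piece `(m, v, z)`, every order
`n` and every point `y`,
`‖Dⁿ (φ̃/W)(y)‖ ≤ ((n+1)² (2p(2p+1) + (2 + 3(2p+1)^4) 6p(2p+1)) 2²⁵ (n+1)²/ℓ)ⁿ`, `ℓ = a · cellSide m`. [folklore] -/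
theorem ptuDeriv_weight_bound : ∀ (a : ℝ) (L p m : ℕ), 0 < a → 1 ≤ L → 2 ≤ p → m ∈ ptuLevels L p →
    (∀ y : (Fin p → EuclideanSpace ℝ (Fin 4)), 1 ≤ ptuW a L p y) →
    ∀ vz ∈ ptuIdx L m p, ∀ (n : ℕ) (y : (Fin p → EuclideanSpace ℝ (Fin 4))),
      ‖iteratedFDeriv ℝ n (ptuWeight a L p m vz.1 vz.2) y‖ ≤
        (((n : ℝ) + 1) ^ 2 * ((2 * (p : ℝ) * (2 * p + 1) + (2 + 3 * (2 * (p : ℝ) + 1) ^ 4) * (6 * (p : ℝ) * (2 * p + 1))) *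
          (2 ^ 25 * ((n : ℝ) + 1) ^ 2 / (a * cellSide m)))) ^ n := by
  intro a L p m ha hL hp hm hW1 vz hvz n y
  set B : ℝ := 2 ^ 25 * ((n : ℝ) + 1) ^ 2 / (a * cellSide m) with hB
  have hℓ : 0 < a * cellSide m := by unfold cellSide; positivity
  have hB0 : 0 ≤ B := by positivity
  set Cp : ℝ := (2 + 3 * (2 * (p : ℝ) + 1) ^ 4) * (6 * (p : ℝ) * (2 * p + 1)) with hCp
  have hCp0 : 0 ≤ Cp := by positivity
  by_cases hy : y ∈ tsupport (ptuPhiTilde a m p vz.1 vz.2)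
  · -- derivatives of `W` and `1/W` at `y`
    have hWc := ptuDeriv_W_contDiff ha hL p
    have hDW := ptuDeriv_W_term ha hL hp hm hvz n hy
    have hinv := ptuDeriv_geom_inv hWc hW1 (N := n) (D := Cp * B) (by positivity) y hDW
    -- derivatives of `φ̃`
    have hd := ptuDeriv_level_D_ge hm
    have hdpos : 0 < ptuD m p := by omega
    have hφ := (ptuDeriv_phiTilde_bound ha m p hdpos vz.1 vz.2 n).2
    have hdS := ptuDeriv_cellSide_le_D hm
    have hle : a * cellSide m ≤ 2 * (2 * (p : ℝ) + 1) * (a * ptuD m p) := by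
      have h := mul_le_mul_of_nonneg_left hdS ha.le
      linarith
    have had : 0 < a * (ptuD m p : ℝ) := by
      have : (0 : ℝ) < ptuD m p := by exact_mod_cast hdpos
      positivity
    have hKφ : (p : ℝ) * (2 ^ 25 * ((n : ℝ) + 1) ^ 2 / (a * ptuD m p)) ≤ 2 * (p : ℝ) * (2 * p + 1) * B := by
      have hX0 : (0 : ℝ) ≤ 2 ^ 25 * ((n : ℝ) + 1) ^ 2 := by positivity
      have key : 2 ^ 25 * ((n : ℝ) + 1) ^ 2 / (a * ptuD m p) ≤
          2 * (2 * (p : ℝ) + 1) * (2 ^ 25 * ((n : ℝ) + 1) ^ 2) / (a * cellSide m) := by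
        rw [div_le_div_iff₀ had hℓ]
        calc 2 ^ 25 * ((n : ℝ) + 1) ^ 2 * (a * cellSide m)
            ≤ 2 ^ 25 * ((n : ℝ) + 1) ^ 2 * (2 * (2 * (p : ℝ) + 1) * (a * ptuD m p)) := mul_le_mul_of_nonneg_left hle hX0
          _ = 2 * (2 * (p : ℝ) + 1) * (2 ^ 25 * ((n : ℝ) + 1) ^ 2) * (a * ptuD m p) := by ring
      calc (p : ℝ) * (2 ^ 25 * ((n : ℝ) + 1) ^ 2 / (a * ptuD m p))
          ≤ (p : ℝ) * (2 * (2 * (p : ℝ) + 1) * (2 ^ 25 * ((n : ℝ) + 1) ^ 2) / (a * cellSide m)) :=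
            mul_le_mul_of_nonneg_left key (Nat.cast_nonneg _)
        _ = 2 * (p : ℝ) * (2 * p + 1) * B := by rw [hB]; ring
    have hφ' : ∀ b ≤ n, ‖iteratedFDeriv ℝ b (ptuPhiTilde a m p vz.1 vz.2) y‖ ≤ (2 * (p : ℝ) * (2 * p + 1) * B) ^ b :=
      fun b hb => (hφ b hb y).trans (pow_le_pow_left₀ (by positivity) hKφ b)
    -- Leibniz
    have hfun : ptuWeight a L p m vz.1 vz.2 = fun y => ptuPhiTilde a m p vz.1 vz.2 y * (ptuW a L p y)⁻¹ := by
      funext y'; unfold ptuWeight; rw [div_eq_mul_inv]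
    have hφc : ContDiff ℝ n (ptuPhiTilde a m p vz.1 vz.2) := (ptuPhiTilde_contDiff _ _ _ _ _).of_le (mod_cast le_top)
    have hic : ContDiff ℝ n (fun y => (ptuW a L p y)⁻¹) :=
      (hWc.inv fun y' => by linarith [hW1 y']).of_le (mod_cast le_top)
    rw [hfun]
    refine (norm_iteratedFDeriv_mul_le_add_pow hφc hic (by positivity) y hφ' hinv le_rfl).trans
      (pow_le_pow_left₀ (by positivity) ?_ n)
    have h1 : (1 : ℝ) ≤ ((n : ℝ) + 1) ^ 2 := by nlinarith [(Nat.cast_nonneg n : (0 : ℝ) ≤ n)]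
    have h2 : 0 ≤ 2 * (p : ℝ) * (2 * p + 1) * B := by positivity
    nlinarith
  · have hnot : y ∉ tsupport (ptuWeight a L p m vz.1 vz.2) := fun h =>
      hy (closure_mono (ptuDeriv_support_weight_subset a L p m vz.1 vz.2) h)
    rw [ptuDeriv_iteratedFDeriv_eq_zero hnot n, norm_zero]
    positivity

end Summit.QuantumFields.YangMills.Theorems.ContinuumLegGivenGap

end
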